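import Literature.MathematicalPhysics.QuantumFieldTheory.ContinuumLimits
import Literature.Analysis.FunctionSpaces.NuclearSpaceSchwartzSeparableProofs
import HarnessLib

/-!
# The joint-limit (diagonal) glue for constructive-qft.S22 (`phi42_exists`)

Sibling proofs file of `Literature/MathematicalPhysics/QuantumFieldTheory/ContinuumLimits.lean`
(theorems only; no statement of that file is changed, no named fact is introduced).

The named fact `phi42_exists` (Glimm–Jaffe–Spencer 1974; Glimm–Jaffe 1987, Chs. 8–12, 18–19)
asserts a limit in law of the *standard* lattice `φ⁴₂` torus measures along the full filter
`δ → 0⁺`, on tori of half-side `L(δ)` with `δ L(δ) → ∞`, `L(·)` and the counterterm `δm²(·)`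
being existential. The printed theorems are *iterated* limits: lattice → continuum on a fixed
region (Glimm–Jaffe 1987, Thm 9.6.4 and its Remark for periodic boundary conditions), then the
infinite-volume limit of the continuum finite-volume states (Thm 11.2.1; for periodic states at
weak coupling §18.1, p. 323, and Guerra–Rosen–Simon, Ann. IHP A 25 (1976) 231). The passage
"iterated ⇒ joint along a slowly growing `L(δ)`" is the standard glue recorded as item (iii) of
"S22, scope" in the module docstring of `ContinuumLimits.lean`: `TendstoInLaw` is pointwise in
the test function, so a diagonal choice needs equicontinuity in `f` (which the uniform moment
bounds of the construction supply) and the separability of `𝒮(ℝ²)`. This file proves that glue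
once and for all, for any family of laws on `𝒮'(E)`:

* `norm_genFunctional_sub_le_integral_abs`: `‖S_μ(g) − S_μ(f)‖ ≤ ∫ |ω(g − f)| dμ` for a
  probability law (`|e^{ix} − 1| ≤ |x|`), and `integral_abs_eval_le_sqrt_integral_sq`:
  `∫ |ω(h)| dμ ≤ (∫ ω(h)² dμ)^{1/2}` (Cauchy–Schwarz);
* `equicontinuous_genFunctional_of_integral_abs_le`: a family of probability laws whose first
  absolute moments are dominated, `∫ |ω(h)| dμ_{i,k} ≤ q(h)` with `q → 0` at `h → 0`, has
  (eventually in `i`, uniformly in `k`) equicontinuous generating functionals;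
* `exists_tendstoInLaw_diagonal` (**the diagonal lemma**): if `μ_{i,k} → ν_k` in law along a
  countably generated filter `l` in `i` for every `k`, `ν_k → μ` in law as `k → ∞`, and the
  generating functionals of the `μ_{i,k}` are eventually equicontinuous, then along some
  `k(i) → ∞` one has `μ_{i,k(i)} → μ` in law along `l`; countably many side conditions
  `P k i`, each holding eventually in `i`, can be imposed on the diagonal (`P (k i) i`
  eventually) — this is how `δ L(δ) → ∞` is obtained;
* `phi42_exists_of_torusLimits`: **`phi42_exists` from the printed, iterated form** — for each
  volume index `k` a lattice → continuum limit in law of the pinned torus laws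
  (`phi4TorusCenteredLaw 2 (L_k δ) (λδ²) (2 + (m² + c(δ,k)) δ²/2) 1 δ 1`, mass counterterm
  `c(δ, k)` allowed to depend on the volume, as the Wick constant `−12 λ C_δ(0)` of the torus
  covariance does, with the printed uniform bound `|c(δ,k)| ≤ C (1 + |log δ|)`), the
  infinite-volume limit in law `ν_k → μ` of the continuum periodic states, eventual
  equicontinuity of the lattice generating functionals, and the axioms OS0–OS4,
  non-Gaussianity and exponential clustering of `μ`.

What is NOT here: any of the substance of the `P(φ)₂` construction (Wick powers and
hypercontractivity, convergence of the lattice approximation, correlation inequalities and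
multiple-reflection bounds, the cluster expansion, uniqueness of the vacuum, perturbative
non-Gaussianity) — the hypotheses of `phi42_exists_of_torusLimits` are exactly these printed
theorems, and the discharge `phi42_exists_holds` remains open.

## References

* J. Glimm, A. Jaffe, *Quantum Physics. A Functional Integral Point of View*, 2nd ed., Springer
  1987: §6.1 (generating functionals), Thm 9.6.4 and Remark (lattice approximation, `d = 2`),
  Thm 11.2.1, Thm 12.1.1, §18.1 (p. 323, boundary conditions), Cor 18.1.3, Thm 19.7.1.
* F. Guerra, L. Rosen, B. Simon, Ann. Inst. H. Poincaré A 25 (1976) 231 (periodic states).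
* P. Billingsley, *Convergence of Probability Measures*, 2nd ed., Wiley 1999, Ch. 1 (weak
  convergence and characteristic functions; the diagonal argument used here is folklore).
-/

noncomputable section

open scoped SchwartzMap
open MeasureTheory Filter Topology Complex
open Literature.MathematicalPhysics.QuantumLattice

namespace Literature.MathematicalPhysics.QuantumFieldTheory

variable {E : Type*} [NormedAddCommGroup E] [NormedSpace ℝ E]

/-! ### Generating functionals: Lipschitz control by the first absolute moment -/

/-- The integrand `ω ↦ e^{iω(f)}` of the generating functional is integrable for a finite law
(norm one, continuous in the weak-* topology). (Glimm–Jaffe 1987, §6.1.) [folklore] -/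
theorem integrable_cexp_I_mul_eval (μ : Measure (FieldConfig E)) [IsFiniteMeasure μ]
    (f : 𝓢(E, ℝ)) : Integrable (fun ω : FieldConfig E => cexp (I * ((ω f : ℝ) : ℂ))) μ := by
  have hcont : Continuous fun ω : FieldConfig E => cexp (I * ((ω f : ℝ) : ℂ)) :=
    Complex.continuous_exp.comp
      (continuous_const.mul (Complex.continuous_ofReal.comp (continuous_eval_const f)))
  exact (integrable_const (1 : ℝ)).mono' hcont.aestronglyMeasurable
    (Eventually.of_forall fun ω => (Complex.norm_exp_I_mul_ofReal _).le)

/-- **Lipschitz control of the generating functional by the first absolute moment.** For a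
probability law `μ` on `𝒮'(E)` and test functions `f, g` with `ω ↦ ω(g − f)` integrable,
`‖S_μ(g) − S_μ(f)‖ ≤ ∫ |ω(g − f)| dμ(ω)`, since `|e^{iy} − e^{ix}| = |e^{i(y−x)} − 1| ≤ |y − x|`.
(Glimm–Jaffe 1987, §6.1; the standard continuity estimate for characteristic functionals.)
[folklore] -/
theorem norm_genFunctional_sub_le_integral_abs (μ : Measure (FieldConfig E))
    [IsProbabilityMeasure μ] (f g : 𝓢(E, ℝ))
    (hint : Integrable (fun ω : FieldConfig E => ω (g - f)) μ) :
    ‖genFunctional μ g - genFunctional μ f‖ ≤ ∫ ω, |ω (g - f)| ∂μ := by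
  unfold genFunctional
  rw [← integral_sub (integrable_cexp_I_mul_eval μ g) (integrable_cexp_I_mul_eval μ f)]
  refine (norm_integral_le_integral_norm _).trans (integral_mono_of_nonneg
    (Eventually.of_forall fun ω => norm_nonneg _) hint.abs (Eventually.of_forall fun ω => ?_))
  -- pointwise: `‖e^{iω(g)} − e^{iω(f)}‖ = ‖e^{iω(f)}‖ ‖e^{iω(g−f)} − 1‖ ≤ |ω(g − f)|`
  have hfac : cexp (I * ((ω g : ℝ) : ℂ)) - cexp (I * ((ω f : ℝ) : ℂ)) =
      cexp (I * ((ω f : ℝ) : ℂ)) * (cexp (I * ((ω (g - f) : ℝ) : ℂ)) - 1) := by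
    rw [mul_sub, mul_one, ← Complex.exp_add, map_sub]
    push_cast
    ring_nf
  show ‖cexp (I * ((ω g : ℝ) : ℂ)) - cexp (I * ((ω f : ℝ) : ℂ))‖ ≤ |ω (g - f)|
  rw [hfac, norm_mul, Complex.norm_exp_I_mul_ofReal, one_mul]
  simpa [Real.norm_eq_abs] using (Real.norm_exp_I_mul_ofReal_sub_one_le (x := ω (g - f)))

/-- **Cauchy–Schwarz for the first absolute moment**: for a probability law and a square
integrable evaluation, `∫ |ω(h)| dμ ≤ (∫ ω(h)² dμ)^{1/2}`. (Glimm–Jaffe 1987, §6.1.) [folklore] -/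
theorem integral_abs_eval_le_sqrt_integral_sq (μ : Measure (FieldConfig E))
    [IsProbabilityMeasure μ] (h : 𝓢(E, ℝ))
    (h2 : MemLp (fun ω : FieldConfig E => ω h) 2 μ) :
    ∫ ω, |ω h| ∂μ ≤ Real.sqrt (∫ ω, (ω h) ^ 2 ∂μ) := by
  have htwo : ENNReal.ofReal (2 : ℝ) = 2 := by simp
  have habs : MemLp (fun ω : FieldConfig E => |ω h|) (ENNReal.ofReal 2) μ := by
    rw [htwo]; exact h2.abs
  have hone : MemLp (fun _ : FieldConfig E => (1 : ℝ)) (ENNReal.ofReal 2) μ := by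
    rw [htwo]; exact memLp_const 1
  have hH := integral_mul_le_Lp_mul_Lq_of_nonneg (μ := μ) Real.HolderConjugate.two_two
    (Eventually.of_forall fun ω => abs_nonneg (ω h)) (Eventually.of_forall fun _ => zero_le_one)
    habs hone
  have hsq : ∫ ω, |ω h| ^ (2 : ℝ) ∂μ = ∫ ω, (ω h) ^ 2 ∂μ :=
    integral_congr_ae (Eventually.of_forall fun ω => by simp)
  calc ∫ ω, |ω h| ∂μ = ∫ ω, |ω h| * 1 ∂μ := by simp
    _ ≤ (∫ ω, |ω h| ^ (2 : ℝ) ∂μ) ^ (1 / (2 : ℝ)) *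
          (∫ _ω : FieldConfig E, (1 : ℝ) ^ (2 : ℝ) ∂μ) ^ (1 / (2 : ℝ)) := hH
    _ = Real.sqrt (∫ ω, (ω h) ^ 2 ∂μ) := by
        rw [hsq, Real.sqrt_eq_rpow]
        simp

/-- **Equicontinuity of generating functionals from dominated first absolute moments.** Let
`μ_{i,k}` be laws on `𝒮'(E)` which, eventually along `l` in `i` and for all `k`, are
probability measures with `∫ |ω(h)| dμ_{i,k} ≤ q(h)` for every test function `h`, where
`q(h) → 0` as `h → 0` in `𝒮(E)` (e.g. `q` a continuous seminorm dominating the two-point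
functions, by `integral_abs_eval_le_sqrt_integral_sq`). Then the generating functionals are
eventually equicontinuous, uniformly in `k`: for every `f` and `ε > 0` there is a neighbourhood
`U` of `f` with `‖S_{i,k}(g) − S_{i,k}(f)‖ ≤ ε` for all `g ∈ U`, all `k`, eventually in `i`.
(Glimm–Jaffe 1987, §6.1; the hypothesis of the diagonal lemma below.) [folklore] -/
theorem equicontinuous_genFunctional_of_integral_abs_le {ι κ : Type*} {l : Filter ι}
    {A : ι → κ → Measure (FieldConfig E)} (q : 𝓢(E, ℝ) → ℝ) (hq : Tendsto q (𝓝 0) (𝓝 0))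
    (hA : ∀ᶠ i in l, ∀ k, IsProbabilityMeasure (A i k) ∧ ∀ h : 𝓢(E, ℝ),
      Integrable (fun ω : FieldConfig E => ω h) (A i k) ∧ ∫ ω, |ω h| ∂(A i k) ≤ q h) :
    ∀ f : 𝓢(E, ℝ), ∀ ε > 0, ∃ U ∈ 𝓝 f, ∀ᶠ i in l, ∀ k, ∀ g ∈ U,
      ‖genFunctional (A i k) g - genFunctional (A i k) f‖ ≤ ε := by
  intro f ε hε
  -- `V = {h | q h ≤ ε}` is a neighbourhood of `0`, `U = f + V` one of `f`
  have hV : {h : 𝓢(E, ℝ) | q h ≤ ε} ∈ 𝓝 (0 : 𝓢(E, ℝ)) := hq (Iic_mem_nhds hε)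
  have hsub : Tendsto (fun g : 𝓢(E, ℝ) => g - f) (𝓝 f) (𝓝 0) := by
    have h := (continuous_sub_right f).tendsto f
    rwa [sub_self] at h
  refine ⟨(fun g : 𝓢(E, ℝ) => g - f) ⁻¹' {h | q h ≤ ε}, hsub hV, ?_⟩
  filter_upwards [hA] with i hi k g hg
  obtain ⟨hprob, hmom⟩ := hi k
  exact (norm_genFunctional_sub_le_integral_abs (A i k) f g (hmom (g - f)).1).trans
    ((hmom (g - f)).2.trans hg)

/-! ### The diagonal lemma -/

/-- **Diagonal lemma for limits in law on `𝒮'`** (iterated limits ⇒ a joint limit along a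
slowly growing diagonal). Let `E` be finite dimensional (so that `𝒮(E)` is separable,
`Literature.Analysis.FunctionSpaces.separableSpace_schwartzMap_holds`), `l` a countably
generated filter on `ι` containing the complement of every point (e.g. `𝓝[>] 0` on `ℝ`, `atTop`
on `ℕ`), and `μ_{i,k}` laws on `𝒮'(E)` with
(1) `μ_{i,k} → ν_k` in law along `l`, for every `k`;
(2) `ν_k → μ` in law as `k → ∞`;
(3) eventually (in `i`, uniformly in `k`) equicontinuous generating functionals;
(4) side conditions `P k i`, each holding eventually in `i`.
Then there is a diagonal `k(i) → ∞` along `l` with `P (k i) i` eventually and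
`μ_{i,k(i)} → μ` in law along `l`. *Proof:* with a dense sequence `(f_m)` of test functions and
an antitone basis `(b_j)` of `l`, choose basis sets `B_k = b_{j_k}`, antitone in `k`, inside the
"good" sets `{i | P k i ∧ ∀ m ≤ k, ‖S_{i,k}(f_m) − S_{ν_k}(f_m)‖ < 1/(k+1)} ∈ l`, and let `k(i)`
be the last `k` with `i ∈ B_k`; convergence on each `f_m` follows, and (3) with the density of
`(f_m)` upgrades it to every `f`. (Standard diagonal argument; the glue (iii) of "S22, scope"
in the module docstring of `ContinuumLimits.lean`; cf. Glimm–Jaffe 1987, §6.1.) [folklore] -/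
theorem exists_tendstoInLaw_diagonal [FiniteDimensional ℝ E] {ι : Type*} {l : Filter ι}
    [l.IsCountablyGenerated] (hl : ∀ i₀ : ι, ∀ᶠ i in l, i ≠ i₀)
    {A : ι → ℕ → Measure (FieldConfig E)} {ν : ℕ → Measure (FieldConfig E)}
    {μ : Measure (FieldConfig E)} {P : ℕ → ι → Prop}
    (hA : ∀ k, TendstoInLaw (fun i => A i k) l (ν k)) (hν : TendstoInLaw ν atTop μ)
    (hE : ∀ f : 𝓢(E, ℝ), ∀ ε > 0, ∃ U ∈ 𝓝 f, ∀ᶠ i in l, ∀ k, ∀ g ∈ U,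
      ‖genFunctional (A i k) g - genFunctional (A i k) f‖ ≤ ε)
    (hP : ∀ k, ∀ᶠ i in l, P k i) :
    ∃ k : ι → ℕ, Tendsto k l atTop ∧ (∀ᶠ i in l, P (k i) i) ∧
      TendstoInLaw (fun i => A i (k i)) l μ := by
  -- the trivial filter
  rcases l.eq_or_neBot with rfl | hlne
  · exact ⟨fun _ => 0, tendsto_bot, eventually_bot, fun _ => tendsto_bot⟩
  -- a dense sequence of test functions and an antitone basis of `l`
  haveI : TopologicalSpace.SeparableSpace 𝓢(E, ℝ) :=
    Literature.Analysis.FunctionSpaces.separableSpace_schwartzMap_holds E ℝ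
  obtain ⟨fs, hfs⟩ := TopologicalSpace.exists_dense_seq 𝓢(E, ℝ)
  obtain ⟨b, hb⟩ := l.exists_antitone_basis
  -- the good sets `G k ∈ l`
  set G : ℕ → Set ι := fun k => {i | P k i ∧ ∀ m ≤ k,
      ‖genFunctional (A i k) (fs m) - genFunctional (ν k) (fs m)‖ < 1 / ((k : ℝ) + 1)} with hG_def
  have hG : ∀ k, G k ∈ l := by
    intro k
    have hpos : (0 : ℝ) < 1 / ((k : ℝ) + 1) := Nat.one_div_pos_of_nat
    have h1 : ∀ m, ∀ᶠ i in l,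
        ‖genFunctional (A i k) (fs m) - genFunctional (ν k) (fs m)‖ < 1 / ((k : ℝ) + 1) :=
      fun m => (tendsto_iff_norm_sub_tendsto_zero.1 (hA k (fs m))).eventually (gt_mem_nhds hpos)
    have h2 : ∀ᶠ i in l, ∀ m ∈ Finset.range (k + 1),
        ‖genFunctional (A i k) (fs m) - genFunctional (ν k) (fs m)‖ < 1 / ((k : ℝ) + 1) :=
      (Finset.eventually_all _).2 fun m _ => h1 m
    filter_upwards [hP k, h2] with i hi1 hi2
    exact ⟨hi1, fun m hm => hi2 m (Finset.mem_range.2 (Nat.lt_succ_of_le hm))⟩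
  -- basis sets inside the good sets, made antitone in `k`: `B k = b (j k)`
  choose j0 hj0 using fun k => hb.mem_iff.1 (hG k)
  set j : ℕ → ℕ := fun k => (Finset.range (k + 1)).sup j0 + k with hj_def
  have hj0_le : ∀ k, j0 k ≤ j k := fun k =>
    (Finset.le_sup (f := j0) (Finset.self_mem_range_succ k)).trans (Nat.le_add_right _ _)
  have hk_le_j : ∀ k, k ≤ j k := fun k => Nat.le_add_left _ _
  have hj_mono : Monotone j := fun k k' hkk' =>
    Nat.add_le_add (Finset.sup_mono (Finset.range_mono (Nat.succ_le_succ hkk'))) hkk'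
  set B : ℕ → Set ι := fun k => b (j k) with hB_def
  have hB_anti : ∀ {k k'}, k ≤ k' → B k' ⊆ B k := fun hkk' => hb.antitone (hj_mono hkk')
  have hBG : ∀ k, B k ⊆ G k := fun k => (hb.antitone (hj0_le k)).trans (hj0 k)
  have hBl : ∀ k, B k ∈ l := fun k => hb.mem (j k)
  -- every `i` eventually leaves the `B k`
  have hex : ∀ i, ∃ k, i ∉ B k := by
    intro i
    obtain ⟨n, hn⟩ := hb.mem_iff.1 (hl i)
    exact ⟨n, fun hi => hn (hb.antitone (hk_le_j n) hi) rfl⟩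
  classical
  -- the diagonal: `k i` = the last `k` with `i ∈ B k` (when `i ∈ B 0`)
  set K : ι → ℕ := fun i => Nat.find (hex i) with hK_def
  have hK_spec : ∀ i, i ∉ B (K i) := fun i => Nat.find_spec (hex i)
  have hK_min : ∀ i k, k < K i → i ∈ B k := fun i k hk => by
    simpa using Nat.find_min (hex i) hk
  -- membership of the diagonal in the good sets, for `i ∈ B 0`
  have hmem : ∀ i, i ∈ B 0 → i ∈ G (K i - 1) := by
    intro i hi
    have hK0 : K i ≠ 0 := fun h0 => hK_spec i (h0 ▸ hi)
    exact hBG _ (hK_min i _ (Nat.sub_one_lt hK0))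
  -- `k i → ∞`
  have htend : Tendsto (fun i => K i - 1) l atTop := by
    refine tendsto_atTop.2 fun N => ?_
    filter_upwards [hBl (N + 1)] with i hi
    have hK : N + 1 < K i := by
      by_contra hle
      exact hK_spec i (hB_anti (not_lt.1 hle) hi)
    omega
  haveI := hlne
  refine ⟨fun i => K i - 1, htend, ?_, ?_⟩
  · filter_upwards [hBl 0] with i hi using (hmem i hi).1
  -- convergence on the dense sequence
  have hconv : ∀ m, Tendsto (fun i => genFunctional (A i (K i - 1)) (fs m)) l
      (𝓝 (genFunctional μ (fs m))) := by
    intro m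
    have hνk : Tendsto (fun i => genFunctional (ν (K i - 1)) (fs m)) l
        (𝓝 (genFunctional μ (fs m))) := (hν (fs m)).comp htend
    refine hνk.congr_dist ?_
    have hsmall : Tendsto (fun i => 1 / (((K i - 1 : ℕ) : ℝ) + 1)) l (𝓝 0) :=
      (tendsto_one_div_add_atTop_nhds_zero_nat (𝕜 := ℝ)).comp htend
    refine squeeze_zero' (Eventually.of_forall fun i => dist_nonneg) ?_ hsmall
    filter_upwards [hBl 0, htend.eventually_ge_atTop m] with i hi him
    rw [dist_comm, dist_eq_norm]
    exact ((hmem i hi).2 m him).le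
  -- the limit functional inherits the modulus of equicontinuity
  have hμcont : ∀ (f : 𝓢(E, ℝ)) (ε : ℝ) (U : Set 𝓢(E, ℝ)),
      (∀ᶠ i in l, ∀ k, ∀ g ∈ U, ‖genFunctional (A i k) g - genFunctional (A i k) f‖ ≤ ε) →
      ∀ g ∈ U, ‖genFunctional μ g - genFunctional μ f‖ ≤ ε := by
    intro f ε U hU g hg
    have hνle : ∀ k, ‖genFunctional (ν k) g - genFunctional (ν k) f‖ ≤ ε := fun k =>
      le_of_tendsto (((hA k g).sub (hA k f)).norm) (hU.mono fun i hi => hi k g hg)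
    exact le_of_tendsto (((hν g).sub (hν f)).norm) (Eventually.of_forall hνle)
  -- conclusion: `ε/3` argument through a dense `f_m ∈ U`
  intro f
  refine Metric.tendsto_nhds.2 fun ε hε => ?_
  have hε3 : 0 < ε / 3 := by positivity
  obtain ⟨U, hU, hUeq⟩ := hE f (ε / 3) hε3
  obtain ⟨m, hm⟩ := hfs.mem_nhds hU
  have hμm : ‖genFunctional μ (fs m) - genFunctional μ f‖ ≤ ε / 3 := hμcont f _ U hUeq _ hm
  filter_upwards [hUeq, Metric.tendsto_nhds.1 (hconv m) (ε / 3) hε3] with i hiU him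
  have h1 : ‖genFunctional (A i (K i - 1)) (fs m) - genFunctional (A i (K i - 1)) f‖ ≤ ε / 3 :=
    hiU _ _ hm
  rw [dist_eq_norm] at him ⊢
  have hsplit : genFunctional (A i (K i - 1)) f - genFunctional μ f =
      (genFunctional (A i (K i - 1)) f - genFunctional (A i (K i - 1)) (fs m)) +
        (genFunctional (A i (K i - 1)) (fs m) - genFunctional μ (fs m)) +
        (genFunctional μ (fs m) - genFunctional μ f) := by ring
  rw [hsplit]
  refine norm_add₃_le.trans_lt ?_
  rw [norm_sub_rev (genFunctional (A i (K i - 1)) f)]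
  linarith

/-! ### `phi42_exists` from the printed (iterated) limits -/

/-- **`phi42_exists` from its printed, iterated form.** Suppose that for every mass `m > 0`
there is `λ₀ > 0` such that for every `0 < λ < λ₀` there are: a mass counterterm `c(δ, k)`
(allowed to depend on the volume index `k`, as the Wick constant `−12 λ C_δ(0)` of the torus
covariance does; Glimm–Jaffe 1987, §9.5–9.6, (9.6.8)) with the printed uniform logarithmic bound
`|c(δ, k)| ≤ C (1 + |log δ|)` on `0 < δ < 1`; lattice half-side schedules `L_k(δ)` with
`k ≤ δ L_k(δ)` for small `δ` (volume number `k` has physical half-side at least `k`); laws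
`ν_k` on `𝒮'(ℝ²)` (the continuum periodic `φ⁴₂` states, restricted to the fundamental
domain) with, for every `k`, the lattice → continuum limit in law `δ → 0⁺` of the pinned torus
laws `phi4TorusCenteredLaw 2 (L_k δ) (λδ²) (2 + (m² + c(δ,k)) δ²/2) 1 δ 1 → ν_k` (Glimm–Jaffe
1987, Thm 9.6.4 and its Remark, `B = p` — printed for moments of a fixed coarser lattice field
at dyadic `δ` on a fixed region; the generating-functional, full-filter, drifting-side form
assumed here keeps glue (i)–(ii) of "S22, scope" inside this hypothesis); the infinite-volume
limit in law `ν_k → μ` of the periodic states (§18.1, p. 323, "independent of the boundary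
conditions", with Thm 11.2.1; Guerra–Rosen–Simon 1976); generating functionals of the lattice
laws equicontinuous in the test function, eventually in `δ` and uniformly in `k` (from moment
bounds uniform in `δ` and the volume, cf. Lemma 9.6.2 and Thm 11.3.1, via
`equicontinuous_genFunctional_of_integral_abs_le`); and `μ` an OS0–OS4 measure, non-Gaussian,
with exponential clustering (Thm 12.1.1, Cor 18.1.3–18.1.4, Thm 19.7.1; Dimock 1974). Then
`phi42_exists` holds: the diagonal lemma `exists_tendstoInLaw_diagonal` produces `k(δ) → ∞`
with `k(δ) ≤ δ L_{k(δ)}(δ)` eventually, and `L(δ) = L_{k(δ)}(δ)`, `δm²(δ) = c(δ, k(δ))` witness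
the statement. This is glue (iii) of "S22, scope" (module docstring of `ContinuumLimits.lean`);
the substance of every hypothesis remains to be proved. [cite: GlimmJaffeQP1987, Thm 9.6.4 and Remark; Thm 11.2.1; §18.1 p. 323] -/
theorem phi42_exists_of_torusLimits
    (h : ∀ m : ℝ, 0 < m → ∃ lam₀ : ℝ, 0 < lam₀ ∧ ∀ lam ∈ Set.Ioo (0 : ℝ) lam₀,
      ∃ (c : ℝ → ℕ → ℝ) (Ls : ℕ → ℝ → ℕ)
        (ν : ℕ → Measure (FieldConfig (EuclideanSpace ℝ (Fin 2))))
        (μ : Measure (FieldConfig (EuclideanSpace ℝ (Fin 2)))),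
        (∃ C : ℝ, ∀ k, ∀ δ ∈ Set.Ioo (0 : ℝ) 1, |c δ k| ≤ C * (1 + |Real.log δ|)) ∧
        (∀ k : ℕ, ∀ᶠ δ in 𝓝[>] (0 : ℝ), (k : ℝ) ≤ δ * Ls k δ) ∧
        (∀ k, TendstoInLaw (fun δ : ℝ => phi4TorusCenteredLaw 2 (Ls k δ) (lam * δ ^ 2)
            (2 + (m ^ 2 + c δ k) * δ ^ 2 / 2) 1 δ 1) (𝓝[>] 0) (ν k)) ∧
        TendstoInLaw ν atTop μ ∧
        (∀ f : 𝓢(EuclideanSpace ℝ (Fin 2), ℝ), ∀ ε > 0, ∃ U ∈ 𝓝 f, ∀ᶠ δ in 𝓝[>] (0 : ℝ),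
          ∀ k, ∀ g ∈ U,
          ‖genFunctional (phi4TorusCenteredLaw 2 (Ls k δ) (lam * δ ^ 2)
                (2 + (m ^ 2 + c δ k) * δ ^ 2 / 2) 1 δ 1) g -
              genFunctional (phi4TorusCenteredLaw 2 (Ls k δ) (lam * δ ^ 2)
                (2 + (m ^ 2 + c δ k) * δ ^ 2 / 2) 1 δ 1) f‖ ≤ ε) ∧
        IsOSMeasure 2 μ ∧ IsNonGaussian μ ∧ ∃ m' : ℝ, HasExponentialClustering 2 μ m') :
    phi42_exists := by
  intro m hm
  obtain ⟨lam₀, hlam₀, hlam⟩ := h m hm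
  refine ⟨lam₀, hlam₀, fun lam hl => ?_⟩
  obtain ⟨c, Ls, ν, μ, ⟨C, hC⟩, hvol, hlat, hν, hE, hOS, hNG, hclust⟩ := hlam lam hl
  -- `𝓝[>] 0` contains the complement of every point
  have hpt : ∀ x : ℝ, ∀ᶠ δ in 𝓝[>] (0 : ℝ), δ ≠ x := by
    intro x
    rcases eq_or_ne x 0 with rfl | hx
    · exact eventually_mem_nhdsWithin.mono fun δ (hδ : 0 < δ) => hδ.ne'
    · exact (eventually_ne_nhds hx.symm).filter_mono nhdsWithin_le_nhds
  obtain ⟨k, hk, hkP, hklim⟩ := exists_tendstoInLaw_diagonal (l := 𝓝[>] (0 : ℝ)) hpt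
    (A := fun δ k => phi4TorusCenteredLaw 2 (Ls k δ) (lam * δ ^ 2)
      (2 + (m ^ 2 + c δ k) * δ ^ 2 / 2) 1 δ 1)
    (P := fun k δ => (k : ℝ) ≤ δ * Ls k δ) hlat hν hE hvol
  refine ⟨fun δ => c δ (k δ), fun δ => Ls (k δ) δ, μ, ⟨C, fun δ hδ => hC _ δ hδ⟩, ?_, hklim,
    hOS, hNG, hclust⟩
  -- `δ L(δ) ≥ k(δ) → ∞`
  exact tendsto_atTop_mono' _ hkP (tendsto_natCast_atTop_atTop.comp hk)

end Literature.MathematicalPhysics.QuantumFieldTheory
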